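import Summits.QuantumFields.YangMills.Theorems.FluctuationComparisonRegPrIntLS2BetaChartTowerVolumeReadSup
import Summits.QuantumFields.YangMills.Theorems.FluctuationComparisonRegPrIntLS2BetaCornerSizeCover
import HarnessLib

/-!
# S2β · (SCT″-c)₁ — «(VOL-R) A CLASS-DOMINATED ROW IS AN `S′`-SHARE»: the generic edition of ✓p839746∕✓p839840 for ✓p839415 `Bsrc_split_le`'s SECOND summand `48·E_R`:
# if the remainder row is dominated by a CLASS times the ℓ²-CORNER SIZE, `R(i+1,y′)² ≤ a(i+1)²·Σ_{b ∈ corners(y′)} ‖X i b‖²`, with `a(i+1)² ≤ A²·(L^{2i}∕L^{2(K−J)})²` (two powers per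
# coarse step, the (BKG) class shape), then `48·Σ_i (L^{K−J−1−(i+1)})²·Σ_{μν y′} R² ≤ 192·d²·A²·S′ ∕ L` — NO gauge condition, NO ℓ²-decay letter (the volume road ✓p839820)

Cell `ym3-torus` (YM ladder rung R3 = continuum `SU(2)` Yang–Mills on the three-torus at fixed lattice data — a RUNG: NOT d = 4, NOT infinite volume, NOT a mass gap,
NOT Clay).  Width seat «width 12» `ym3-torus-px12` (gen 27); crux `stmt-QuantumFields-20520`, LINE g18-1 S2β; COUNT «VOL-R» (2026-09-01T01:52Z): the three pieces of
(β-3)′'s remainder `R ≤ κ·M² + c·Ō·M + c′·Ō²` are class-dominated rows — `κM²` with `a = κ·M̄` ((BKG) class, constant window), `Ō²` with `a = c′·Λ²L^{−2(t+1)}·M̄` ((REG-UP)@rep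
ratio profile `Ō ≤ Λ·L^{−(t+1)}·M`), `Ō·M` with `a = c·Λ·L^{−(t+1)}·M̄_i` and the SIZE profile `M̄_i ≤ m·L^{−(t+1)}` — so each lands here with its own `A`; the purse road for
`Ō·M` is log-divergent for every weight (`(Σw)(Σ1∕w) ≥ (K−J)²`).  `--kind proof --supports stmt-QuantumFields-20520 --as helper`, count-neutral, DEFINITION-FREE (0 `def`,
0 `instance`, 0 `notation`, 0 `sorry`, default heartbeats).

WHAT IS PROVED (sorry-free).  ★`level_share_le` — per level `i < K−J`: `(L^{K−J−1−(i+1)})²·(A²·(L^{2i}∕L^{2(K−J)})²)·(L^{3(K−J−i)}·E) ≤ A²·(L^{K−J−1−i}·E) ∕ L` for `E ≥ 0`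
(exponent ledger `2(K−J−2−i) + 4i + 3(K−J−i) + 1 ≤ 4(K−J) + (K−J−1−i)`, margin `L^{−2}`, equality at the truncated top level).  ★★★**`ER_le_beta_Sprime`**: for the quaternionic
chart tower `X` (`hXdef`), ANY row `R : Fin d → Fin d → (i : ℕ) → Site (F.P K) i → ℝ`, class `a : ℕ → ℝ` and constant `A` with the displayed `hRa`∕`ha`:
**`48·Σ_{i<K−J} L^{K−J−1−(i+1)}·L^{K−J−1−(i+1)}·Σ_μΣ_νΣ_{y′ : Site (F.P K)(i+1)} R μ ν (i+1) y′² ≤ 192·d²·A²·S′ ∕ L`** with `S′` = ✓p838904 `c1Budget_of_letters`'s dite text VERBATIM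
(corner double count ✓`sum_sum_corner_le`, (L2-VOL) ✓`sum_sq_chartTower_le_vol_readSup_X` termwise after ✓`Finset.sum_range_reflect`, levels transported by substitution).
USE.  `Bsrc := 3E_lin + 48E_R + 3E_J` (✓p839415 at `w j := L^{K−J−1−j}`): `3E_lin` by ✓p839840, `48E_R` by THIS file once (β-3)′'s `R` is shown class-dominated (inhabit `hRa`∕`ha`
from (REG-UP)@rep's profiles + ✓p839707's κ-class), `E_J` by (SUP-DECAY)₀ — all on the `S′` column, window constants last (RULING «FB-σ»).

HONEST SCOPE.  Exponent∕index bookkeeping; `hRa`, `ha` are HYPOTHESES (their inhabitation at the Thm-2 representative is (REG-UP)∕(RES-u)∕`B8Thm2AtT3Members` business); nothing of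
Bałaban's renormalisation-group analysis is asserted or proved ([Balaban1985Averaging] (2)–(3) p.17, Prop. 4 (128)–(135) pp.37–38; [Balaban1987RG1] (0.11) p.253); GAP♯∘
(`stub_uniformFibreGapOrbit`, registry 3732b7df UNTOUCHED, 0∕5), S2β, the five registered stubs, crux 20520, 19936, 19200 and `YM3TorusSU2` are NOT proved; no registered stub is
closed; rung R3 — NOT d = 4, NOT infinite volume, NOT a mass gap, NOT Clay; the Yang–Mills mass gap is NOT proved.
-/

set_option autoImplicit false

noncomputable section

open scoped Matrix.Norms.L2Operator
open Finset

namespace Summit.QuantumFields.YangMills.Theorems.FluctuationComparisonRegPrIntLS2BetaRowEnergyShareOfVol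

open Literature.MathematicalPhysics.QuantumFieldTheory.Balaban1983to89
open Literature.MathematicalPhysics.QuantumFieldTheory.Balaban1983to89.T4Continuum
open Literature.MathematicalPhysics.QuantumFieldTheory.Balaban1983to89.T3ContinuumYM3Torus
open Literature.MathematicalPhysics.QuantumFieldTheory.Balaban1983to89.T3LevelShift
open Literature.MathematicalPhysics.QuantumFieldTheory.Balaban1983to89.T3TiltDescent
open Literature.MathematicalPhysics.QuantumFieldTheory.Balaban1983to89.T3UnitLawDensityEML (ℰp)
open Literature.MathematicalPhysics.QuantumFieldTheory.Balaban1983to89.T4HaarSU2ExpChart (expPoint)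
open Literature.MathematicalPhysics.QuantumFieldTheory.Balaban1983to89.T4ExpWindowSmallField (logVec)
open Literature.MathematicalPhysics.QuantumFieldTheory.Balaban1983to89.HaarExponentialChart
open Literature.MathematicalPhysics.QuantumFieldTheory.Balaban1983to89.BlockAveraging (blockAvg)
open Literature.MathematicalPhysics.QuantumFieldTheory.Balaban1983to89.B14.Eq22Determines (blockIter)
open Literature.MathematicalPhysics.QuantumFieldTheory.Balaban1983to89.B10Eq27TorusAxialLog (rel)
open Literature.MathematicalPhysics.QuantumFieldTheory.Balaban1983to89.B10Eq18SigmaSU2 (su2Coord)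
open Literature.MathematicalPhysics.QuantumFieldTheory.Balaban1983to89.B10Eq18SigmaSU2Haar (rev)
open Literature.MathematicalPhysics.QuantumLattice (su2Quat)
open Summit.QuantumFields.YangMills.Theorems.FluctuationComparisonRegPrIntLS2BetaChartReadDescentOntoExpPoint (su2Coord_rev_mem_lie)
open Summit.QuantumFields.YangMills.Theorems.FluctuationComparisonRegPrIntLS2BetaCornerSizeCover (sum_sum_corner_le)
open Summit.QuantumFields.YangMills.Theorems.FluctuationComparisonRegPrIntLS2BetaChartTowerVolumeReadSup (sum_sq_chartTower_le_vol_readSup_X)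

variable (F : T3Family)

/-- ★ **PER LEVEL** (the exponent ledger of the volume road): for `i < K−J`, `0 ≤ E`, `0 ≤ A²`-free,
`(L^{K−J−1−(i+1)})²·(A²·(L^{2i}∕L^{2(K−J)})²)·(L^{3(K−J−i)}·E) ≤ A²·(L^{K−J−1−i}·E) ∕ L`. [cite: Balaban1985Averaging, Prop. 4 (128)-(135) pp.37-38] -/
theorem level_share_le {J K : ℕ} (i : ℕ) (hi : i < K - J) (A E : ℝ) (hE : 0 ≤ E) :
    (F.L : ℝ) ^ (K - J - 1 - (i + 1)) * (F.L : ℝ) ^ (K - J - 1 - (i + 1)) *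
        (A ^ 2 * ((F.L : ℝ) ^ (2 * i) / (F.L : ℝ) ^ (2 * (K - J))) ^ 2 * ((F.L : ℝ) ^ (3 * (K - J - i)) * E)) ≤
      A ^ 2 * ((F.L : ℝ) ^ (K - J - 1 - i) * E) / (F.L : ℝ) := by
  have hL2' : (2 : ℝ) ≤ (F.L : ℝ) := by exact_mod_cast F.hL.2
  have hL0 : (0 : ℝ) < (F.L : ℝ) := by linarith
  have hL1 : (1 : ℝ) ≤ (F.L : ℝ) := by linarith
  rw [le_div_iff₀ hL0, div_pow, ← pow_mul, ← pow_mul]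
  have hne : (F.L : ℝ) ^ (2 * (K - J) * 2) ≠ 0 := pow_ne_zero _ hL0.ne'
  rw [div_eq_mul_inv]
  -- clear the denominator: multiply both sides by L^{4(K−J)}
  have key : (F.L : ℝ) ^ (K - J - 1 - (i + 1)) * (F.L : ℝ) ^ (K - J - 1 - (i + 1)) * (F.L : ℝ) ^ (2 * i * 2) * (F.L : ℝ) ^ (3 * (K - J - i)) * (F.L : ℝ) ≤
      (F.L : ℝ) ^ (K - J - 1 - i) * (F.L : ℝ) ^ (2 * (K - J) * 2) := by
    rw [← pow_add, ← pow_add, ← pow_add, ← pow_succ, ← pow_add]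
    exact pow_le_pow_right₀ hL1 (by omega)
  have hA : 0 ≤ A ^ 2 * E := mul_nonneg (sq_nonneg _) hE
  have hinv : 0 < ((F.L : ℝ) ^ (2 * (K - J) * 2))⁻¹ := inv_pos.2 (pow_pos hL0 _)
  calc (F.L : ℝ) ^ (K - J - 1 - (i + 1)) * (F.L : ℝ) ^ (K - J - 1 - (i + 1)) *
        (A ^ 2 * ((F.L : ℝ) ^ (2 * i * 2) * ((F.L : ℝ) ^ (2 * (K - J) * 2))⁻¹) * ((F.L : ℝ) ^ (3 * (K - J - i)) * E)) * (F.L : ℝ)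
      = (A ^ 2 * E) * ((F.L : ℝ) ^ (2 * (K - J) * 2))⁻¹ *
          ((F.L : ℝ) ^ (K - J - 1 - (i + 1)) * (F.L : ℝ) ^ (K - J - 1 - (i + 1)) * (F.L : ℝ) ^ (2 * i * 2) * (F.L : ℝ) ^ (3 * (K - J - i)) * (F.L : ℝ)) := by ring
    _ ≤ (A ^ 2 * E) * ((F.L : ℝ) ^ (2 * (K - J) * 2))⁻¹ * ((F.L : ℝ) ^ (K - J - 1 - i) * (F.L : ℝ) ^ (2 * (K - J) * 2)) :=
        mul_le_mul_of_nonneg_left key (mul_nonneg hA hinv.le)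
    _ = A ^ 2 * ((F.L : ℝ) ^ (K - J - 1 - i) * E) := by
        field_simp

/-- ★★★ **(VOL-R) A CLASS-DOMINATED ROW IS AN `S′`-SHARE** — see the module header: `48·E_R ≤ 192·d²·A²·S′ ∕ L` for ANY row `R` with `R² ≤ a²·(corner energy of X i)` and
`a(i+1)² ≤ A²·(L^{2i}∕L^{2(K−J)})²`. [cite: Balaban1985Averaging, (2)-(3) p.17, Prop. 4 (128)-(135) pp.37-38; Balaban1987RG1, (0.1)-(0.4), (0.11) pp.251-253] -/
theorem ER_le_beta_Sprime {J K : ℕ} (hJK : J ≤ K)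
    (U₀ : GaugeField (F.P K) 0 (Matrix.specialUnitaryGroup (Fin 2) ℂ)) (ζ : PBond (F.P K) 0 → EuclideanSpace ℝ (Fin 3))
    (X : (i : ℕ) → PBond (F.P K) i → (specialUnitaryLogChart (Fin 2)).lie)
    (hXdef : X = fun (i : ℕ) (b : PBond (F.P K) i) =>
      (⟨su2Coord (rev (logVec (su2Quat (Averaging.iter (fun k => BlockAveraging.blockAvg (P := F.P K) (j := k) ℰp) i (fun ℓ => expPoint (ζ ℓ) * U₀ ℓ : GaugeField (F.P K) 0 (Matrix.specialUnitaryGroup (Fin 2) ℂ)) b * (Averaging.iter (fun k => BlockAveraging.blockAvg (P := F.P K) (j := k) ℰp) i U₀ b)⁻¹)))), su2Coord_rev_mem_lie _⟩ : (specialUnitaryLogChart (Fin 2)).lie))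
    (R : Fin (F.P K).d → Fin (F.P K).d → (i : ℕ) → Site (F.P K) i → ℝ)
    (a : ℕ → ℝ) (A : ℝ)
    (hRa : ∀ (μ ν : Fin (F.P K).d) (i : ℕ), i < K - J → ∀ y' : Site (F.P K) (i + 1),
      R μ ν (i + 1) y' ^ 2 ≤ a (i + 1) ^ 2 * ∑ b ∈ univ.filter (fun b : PBond (F.P K) i =>
        blockOf b.src = y' ∨ blockOf b.src = y'.shift μ ∨ blockOf b.src = y'.shift ν ∨ blockOf b.src = (y'.shift μ).shift ν), ‖X i b‖ ^ 2)
    (ha : ∀ i, i < K - J → a (i + 1) ^ 2 ≤ A ^ 2 * ((F.L : ℝ) ^ (2 * i) / (F.L : ℝ) ^ (2 * (K - J))) ^ 2) :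
    48 * ∑ i ∈ Finset.range (K - J), (F.L : ℝ) ^ (K - J - 1 - (i + 1)) * (F.L : ℝ) ^ (K - J - 1 - (i + 1)) *
          ∑ μ : Fin (F.P K).d, ∑ ν : Fin (F.P K).d, ∑ y' : Site (F.P K) (i + 1), R μ ν (i + 1) y' ^ 2 ≤
      192 * ((F.P K).d : ℝ) ^ 2 * A ^ 2 *
        (∑ t ∈ Finset.range (K - J), (if ht : t < K - J then
          (F.L : ℝ) ^ t * ∑ B : PBond (F.P J) 0,
            ‖(fun ℓ' : PBond (F.P (J + (t + 1))) 0 =>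
              if ∃ z : Site (F.P (J + (t + 1))) 0,
                (B14.Eq22Determines.blockIter (t + 1) z = (bondShift (F.sitesPerDir_eq (m := F.m) (K := J) (j := 0) (m' := F.m) (K' := J + (t + 1)) (j' := t + 1) (by omega)) B).src ∨ B14.Eq22Determines.blockIter (t + 1) z = (bondShift (F.sitesPerDir_eq (m := F.m) (K := J) (j := 0) (m' := F.m) (K' := J + (t + 1)) (j' := t + 1) (by omega)) B).tgt) ∧
                ∀ ν, (B10Eq27TorusAxialLog.rel z ℓ'.src ν).natAbs ≤ 2
              then logVec (su2Quat (descendTo F ℰp (J + (t + 1)) K (by omega) (fun ℓ => expPoint (ζ ℓ) * U₀ ℓ : GaugeField (F.P K) 0 (Matrix.specialUnitaryGroup (Fin 2) ℂ)) ℓ' * (descendTo F ℰp (J + (t + 1)) K (by omega) U₀ ℓ')⁻¹)) else 0)‖ ^ 2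
        else 0)) / (F.L : ℝ) := by
  have hL2' : (2 : ℝ) ≤ (F.L : ℝ) := by exact_mod_cast F.hL.2
  have hL0 : (0 : ℝ) < (F.L : ℝ) := by linarith
  -- (1) per level: corner double count, class bound, volume road, exponent ledger
  have hlev : ∀ i ∈ Finset.range (K - J),
      (F.L : ℝ) ^ (K - J - 1 - (i + 1)) * (F.L : ℝ) ^ (K - J - 1 - (i + 1)) *
          ∑ μ : Fin (F.P K).d, ∑ ν : Fin (F.P K).d, ∑ y' : Site (F.P K) (i + 1), R μ ν (i + 1) y' ^ 2 ≤
        4 * ((F.P K).d : ℝ) ^ 2 * A ^ 2 * ((F.L : ℝ) ^ (K - J - 1 - i) *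
          ((∑ b : PBond (F.P K) i, ‖X i b‖ ^ 2) / (F.L : ℝ) ^ (3 * (K - J - i)))) / (F.L : ℝ) := by
    intro i hi
    have hi' : i < K - J := Finset.mem_range.1 hi
    -- corner double count
    have hcorner := sum_sum_corner_le (P := F.P K) (k := i) (fun b => ‖X i b‖ ^ 2) (fun b => sq_nonneg _)
    have hrow : ∑ μ : Fin (F.P K).d, ∑ ν : Fin (F.P K).d, ∑ y' : Site (F.P K) (i + 1), R μ ν (i + 1) y' ^ 2 ≤
        a (i + 1) ^ 2 * (4 * ((F.P K).d : ℝ) ^ 2 * ∑ b : PBond (F.P K) i, ‖X i b‖ ^ 2) := by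
      calc ∑ μ : Fin (F.P K).d, ∑ ν : Fin (F.P K).d, ∑ y' : Site (F.P K) (i + 1), R μ ν (i + 1) y' ^ 2
          ≤ ∑ μ : Fin (F.P K).d, ∑ ν : Fin (F.P K).d, ∑ y' : Site (F.P K) (i + 1), a (i + 1) ^ 2 * ∑ b ∈ univ.filter (fun b : PBond (F.P K) i =>
              blockOf b.src = y' ∨ blockOf b.src = y'.shift μ ∨ blockOf b.src = y'.shift ν ∨ blockOf b.src = (y'.shift μ).shift ν), ‖X i b‖ ^ 2 :=
            Finset.sum_le_sum fun μ _ => Finset.sum_le_sum fun ν _ => Finset.sum_le_sum fun y' _ => hRa μ ν i hi' y'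
        _ = a (i + 1) ^ 2 * ∑ μ : Fin (F.P K).d, ∑ ν : Fin (F.P K).d, ∑ y' : Site (F.P K) (i + 1), ∑ b ∈ univ.filter (fun b : PBond (F.P K) i =>
              blockOf b.src = y' ∨ blockOf b.src = y'.shift μ ∨ blockOf b.src = y'.shift ν ∨ blockOf b.src = (y'.shift μ).shift ν), ‖X i b‖ ^ 2 := by
            simp only [Finset.mul_sum]
        _ ≤ a (i + 1) ^ 2 * (4 * ((F.P K).d : ℝ) ^ 2 * ∑ b : PBond (F.P K) i, ‖X i b‖ ^ 2) :=
            mul_le_mul_of_nonneg_left hcorner (sq_nonneg _)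
    -- the volume identity `S_i = L^{3(K−J−i)} · (S_i / L^{3(K−J−i)})`
    have hvol : ∑ b : PBond (F.P K) i, ‖X i b‖ ^ 2 = (F.L : ℝ) ^ (3 * (K - J - i)) * ((∑ b : PBond (F.P K) i, ‖X i b‖ ^ 2) / (F.L : ℝ) ^ (3 * (K - J - i))) := by
      rw [mul_div_cancel₀ _ (pow_ne_zero _ hL0.ne')]
    have hE : 0 ≤ (∑ b : PBond (F.P K) i, ‖X i b‖ ^ 2) / (F.L : ℝ) ^ (3 * (K - J - i)) :=
      div_nonneg (Finset.sum_nonneg fun _ _ => sq_nonneg _) (pow_nonneg hL0.le _)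
    have hw : 0 ≤ (F.L : ℝ) ^ (K - J - 1 - (i + 1)) * (F.L : ℝ) ^ (K - J - 1 - (i + 1)) := mul_nonneg (pow_nonneg hL0.le _) (pow_nonneg hL0.le _)
    have hlev0 := level_share_le F (J := J) (K := K) i hi' A ((∑ b : PBond (F.P K) i, ‖X i b‖ ^ 2) / (F.L : ℝ) ^ (3 * (K - J - i))) hE
    have hd : 0 ≤ 4 * ((F.P K).d : ℝ) ^ 2 := by positivity
    calc (F.L : ℝ) ^ (K - J - 1 - (i + 1)) * (F.L : ℝ) ^ (K - J - 1 - (i + 1)) *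
          ∑ μ : Fin (F.P K).d, ∑ ν : Fin (F.P K).d, ∑ y' : Site (F.P K) (i + 1), R μ ν (i + 1) y' ^ 2
        ≤ (F.L : ℝ) ^ (K - J - 1 - (i + 1)) * (F.L : ℝ) ^ (K - J - 1 - (i + 1)) *
          (a (i + 1) ^ 2 * (4 * ((F.P K).d : ℝ) ^ 2 * ∑ b : PBond (F.P K) i, ‖X i b‖ ^ 2)) := mul_le_mul_of_nonneg_left hrow hw
      _ ≤ (F.L : ℝ) ^ (K - J - 1 - (i + 1)) * (F.L : ℝ) ^ (K - J - 1 - (i + 1)) *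
          ((A ^ 2 * ((F.L : ℝ) ^ (2 * i) / (F.L : ℝ) ^ (2 * (K - J))) ^ 2) * (4 * ((F.P K).d : ℝ) ^ 2 * ∑ b : PBond (F.P K) i, ‖X i b‖ ^ 2)) :=
          mul_le_mul_of_nonneg_left (mul_le_mul_of_nonneg_right (ha i hi') (mul_nonneg hd (Finset.sum_nonneg fun _ _ => sq_nonneg _))) hw
      _ = 4 * ((F.P K).d : ℝ) ^ 2 * ((F.L : ℝ) ^ (K - J - 1 - (i + 1)) * (F.L : ℝ) ^ (K - J - 1 - (i + 1)) *
          (A ^ 2 * ((F.L : ℝ) ^ (2 * i) / (F.L : ℝ) ^ (2 * (K - J))) ^ 2 * ((F.L : ℝ) ^ (3 * (K - J - i)) * ((∑ b : PBond (F.P K) i, ‖X i b‖ ^ 2) / (F.L : ℝ) ^ (3 * (K - J - i)))))) := by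
          rw [← hvol]; ring
      _ ≤ 4 * ((F.P K).d : ℝ) ^ 2 * (A ^ 2 * ((F.L : ℝ) ^ (K - J - 1 - i) * ((∑ b : PBond (F.P K) i, ‖X i b‖ ^ 2) / (F.L : ℝ) ^ (3 * (K - J - i)))) / (F.L : ℝ)) :=
          mul_le_mul_of_nonneg_left hlev0 hd
      _ = _ := by ring
  -- (2) sum the levels
  have hsum := Finset.sum_le_sum hlev
  rw [← Finset.sum_div, ← Finset.mul_sum] at hsum
  -- (3) the bracket `Σ_i L^{K−J−1−i}·E i ≤ S′` by (L2-VOL), termwise after reflection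
  have hbr : ∑ i ∈ Finset.range (K - J), (F.L : ℝ) ^ (K - J - 1 - i) * ((∑ b : PBond (F.P K) i, ‖X i b‖ ^ 2) / (F.L : ℝ) ^ (3 * (K - J - i))) ≤
      ∑ t ∈ Finset.range (K - J), (if ht : t < K - J then
          (F.L : ℝ) ^ t * ∑ B : PBond (F.P J) 0,
            ‖(fun ℓ' : PBond (F.P (J + (t + 1))) 0 =>
              if ∃ z : Site (F.P (J + (t + 1))) 0,
                (B14.Eq22Determines.blockIter (t + 1) z = (bondShift (F.sitesPerDir_eq (m := F.m) (K := J) (j := 0) (m' := F.m) (K' := J + (t + 1)) (j' := t + 1) (by omega)) B).src ∨ B14.Eq22Determines.blockIter (t + 1) z = (bondShift (F.sitesPerDir_eq (m := F.m) (K := J) (j := 0) (m' := F.m) (K' := J + (t + 1)) (j' := t + 1) (by omega)) B).tgt) ∧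
                ∀ ν, (B10Eq27TorusAxialLog.rel z ℓ'.src ν).natAbs ≤ 2
              then logVec (su2Quat (descendTo F ℰp (J + (t + 1)) K (by omega) (fun ℓ => expPoint (ζ ℓ) * U₀ ℓ : GaugeField (F.P K) 0 (Matrix.specialUnitaryGroup (Fin 2) ℂ)) ℓ' * (descendTo F ℰp (J + (t + 1)) K (by omega) U₀ ℓ')⁻¹)) else 0)‖ ^ 2
        else 0) := by
    conv_rhs => rw [← Finset.sum_range_reflect]
    refine Finset.sum_le_sum fun i hi => ?_
    have hi' : i < K - J := Finset.mem_range.1 hi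
    beta_reduce
    rw [dif_pos (show K - J - 1 - i < K - J by omega)]
    refine mul_le_mul_of_nonneg_left ?_ (pow_nonneg hL0.le _)
    rw [div_le_iff₀ (pow_pos hL0 _)]
    have h1 := sum_sq_chartTower_le_vol_readSup_X F (J := J) (K := K) (t := K - J - 1 - i) (by omega) U₀ ζ X hXdef
    have key : ∀ n : ℕ, n = i → ∀ Rr : ℝ, (∑ b : PBond (F.P K) n, ‖X n b‖ ^ 2 ≤ Rr) → ∑ b : PBond (F.P K) i, ‖X i b‖ ^ 2 ≤ Rr := by
      rintro n rfl Rr h; exact h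
    have h2 := key _ (by omega) _ h1
    refine h2.trans (le_of_eq ?_)
    rw [← pow_mul, show 3 * (K - J - 1 - i + 1) = 3 * (K - J - i) from by omega]
    exact mul_comm _ _
  have hC : 0 ≤ 48 * (4 * ((F.P K).d : ℝ) ^ 2 * A ^ 2) := by positivity
  calc 48 * ∑ i ∈ Finset.range (K - J), (F.L : ℝ) ^ (K - J - 1 - (i + 1)) * (F.L : ℝ) ^ (K - J - 1 - (i + 1)) *
          ∑ μ : Fin (F.P K).d, ∑ ν : Fin (F.P K).d, ∑ y' : Site (F.P K) (i + 1), R μ ν (i + 1) y' ^ 2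
      ≤ 48 * ((4 * ((F.P K).d : ℝ) ^ 2 * A ^ 2 * ∑ i ∈ Finset.range (K - J), (F.L : ℝ) ^ (K - J - 1 - i) *
          ((∑ b : PBond (F.P K) i, ‖X i b‖ ^ 2) / (F.L : ℝ) ^ (3 * (K - J - i)))) / (F.L : ℝ)) :=
        mul_le_mul_of_nonneg_left hsum (by norm_num)
    _ = 48 * (4 * ((F.P K).d : ℝ) ^ 2 * A ^ 2) * (∑ i ∈ Finset.range (K - J), (F.L : ℝ) ^ (K - J - 1 - i) *
          ((∑ b : PBond (F.P K) i, ‖X i b‖ ^ 2) / (F.L : ℝ) ^ (3 * (K - J - i)))) / (F.L : ℝ) := by ring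
    _ ≤ 48 * (4 * ((F.P K).d : ℝ) ^ 2 * A ^ 2) * (∑ t ∈ Finset.range (K - J), (if ht : t < K - J then
          (F.L : ℝ) ^ t * ∑ B : PBond (F.P J) 0,
            ‖(fun ℓ' : PBond (F.P (J + (t + 1))) 0 =>
              if ∃ z : Site (F.P (J + (t + 1))) 0,
                (B14.Eq22Determines.blockIter (t + 1) z = (bondShift (F.sitesPerDir_eq (m := F.m) (K := J) (j := 0) (m' := F.m) (K' := J + (t + 1)) (j' := t + 1) (by omega)) B).src ∨ B14.Eq22Determines.blockIter (t + 1) z = (bondShift (F.sitesPerDir_eq (m := F.m) (K := J) (j := 0) (m' := F.m) (K' := J + (t + 1)) (j' := t + 1) (by omega)) B).tgt) ∧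
                ∀ ν, (B10Eq27TorusAxialLog.rel z ℓ'.src ν).natAbs ≤ 2
              then logVec (su2Quat (descendTo F ℰp (J + (t + 1)) K (by omega) (fun ℓ => expPoint (ζ ℓ) * U₀ ℓ : GaugeField (F.P K) 0 (Matrix.specialUnitaryGroup (Fin 2) ℂ)) ℓ' * (descendTo F ℰp (J + (t + 1)) K (by omega) U₀ ℓ')⁻¹)) else 0)‖ ^ 2
        else 0)) / (F.L : ℝ) :=
        div_le_div_of_nonneg_right (mul_le_mul_of_nonneg_left hbr hC) hL0.le
    _ = _ := by ring

end Summit.QuantumFields.YangMills.Theorems.FluctuationComparisonRegPrIntLS2BetaRowEnergyShareOfVol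

end
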